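import Literature.MathematicalPhysics.QuantumLattice.DuhamelTwoPoint

/-!
# Route BalabanIR — crux `BirGroundStateAverageLRO` (item `stmt-HubbardSuperconductivity-2079`), line `Sketch` (softmin-pair-penalty): compression of sector Gibbs weights to an orthonormal frame

For an isometry `B : ℂᵏ → ℂⁿ` (`Bᴴ B = 1`) whose range projection `P = B Bᴴ` commutes with a
Hermitian `M`, the Gibbs weight compresses: `Bᴴ e^{-βM} B = e^{-β BᴴMB}`
(`frame_conjTranspose_gibbsWeight_mul`). Consequently the SECTOR partition function and the
sector Gibbs numerators of `M` on `range P` are the ordinary ones of the compressed Hamiltonian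
`M̃ = Bᴴ M B` on `ℂᵏ` (`sector_trace_gibbsWeight_eq`, `sector_trace_gibbsWeight_mul_eq`), so every
finite-dimensional thermodynamic inequality of the tree (Peierls–Bogoliubov, energy–entropy
bounds, …) transfers to symmetry sectors. Used by line `Sketch` for the entropy-dial (isotropic,
`β_L = θL`) form of the softmin transfer.

On the way: `gibbsWeight_mulVec_of_eigenvector` (`e^{-βM} v = e^{-βλ} v` for `M v = λ v`).

Sources: H. Tasaki, *Physics and Mathematics of Quantum Many-Body Systems* (2020), App. A;
B. Simon, *The Statistical Mechanics of Lattice Gases* I (1993) §I.8. Folklore; no definition is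
introduced.
-/

noncomputable section

namespace Summit.HubbardSuperconductivity.HubbardSuperconductivity.Theorems.BirGroundStateAverageLRO.Softmin

open Matrix Finset Literature.MathematicalPhysics.QuantumLattice
open scoped ComplexOrder

variable {n : Type*} [Fintype n] [DecidableEq n]

/-- **`e^{-βM} v = e^{-βλ} v` for an eigenvector `v` of a Hermitian `M`** (in an eigenbasis
`M = U diag(d) U⋆`, the coefficient vector `U⋆v` is supported where `dᵢ = λ`). [folklore] -/
theorem gibbsWeight_mulVec_of_eigenvector {M : Matrix n n ℂ} (hM : M.IsHermitian) {v : n → ℂ}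
    {lam : ℝ} (hv : M *ᵥ v = ((lam : ℝ) : ℂ) • v) (β : ℝ) :
    gibbsWeight β M *ᵥ v = ((Real.exp (-(β * lam)) : ℝ) : ℂ) • v := by
  set U : Matrix n n ℂ := (hM.eigenvectorUnitary : Matrix n n ℂ) with hU
  have hUu : U ∈ unitary (Matrix n n ℂ) := hM.eigenvectorUnitary.prop
  set w : n → ℂ := star U *ᵥ v with hw
  -- `diag(d) w = λ w`
  have hMv : M *ᵥ v = U *ᵥ (diagonal (fun i => (hM.eigenvalues i : ℂ)) *ᵥ w) := by
    conv_lhs => rw [hM.eq_conj_diagonal]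
    rw [← hU, hw, ← mulVec_mulVec, ← mulVec_mulVec]
  have hDw : diagonal (fun i => (hM.eigenvalues i : ℂ)) *ᵥ w = ((lam : ℝ) : ℂ) • w := by
    have h1 : star U *ᵥ (U *ᵥ (diagonal (fun i => (hM.eigenvalues i : ℂ)) *ᵥ w)) =
        star U *ᵥ (((lam : ℝ) : ℂ) • v) := by rw [← hMv, hv]
    rwa [mulVec_mulVec, Unitary.star_mul_self_of_mem hUu, one_mulVec, mulVec_smul, ← hw] at h1
  -- hence `w i ≠ 0 → d i = λ`, and `diag(e^{-βd}) w = e^{-βλ} w`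
  have hsupp : ∀ i, w i ≠ 0 → hM.eigenvalues i = lam := by
    intro i hi
    have := congrFun hDw i
    rw [mulVec_diagonal, Pi.smul_apply, smul_eq_mul] at this
    have h2 : ((hM.eigenvalues i : ℂ) - (lam : ℂ)) * w i = 0 := by rw [sub_mul, this, sub_self]
    rcases mul_eq_zero.1 h2 with h3 | h3
    · exact_mod_cast sub_eq_zero.1 h3
    · exact absurd h3 hi
  have hEw : diagonal (fun i => (Real.exp (-(β * hM.eigenvalues i)) : ℂ)) *ᵥ w =
      ((Real.exp (-(β * lam)) : ℝ) : ℂ) • w := by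
    funext i
    rw [mulVec_diagonal, Pi.smul_apply, smul_eq_mul]
    by_cases hi : w i = 0
    · rw [hi, mul_zero, mul_zero]
    · rw [hsupp i hi]
  -- reassemble
  calc gibbsWeight β M *ᵥ v
      = U *ᵥ (diagonal (fun i => (Real.exp (-(β * hM.eigenvalues i)) : ℂ)) *ᵥ w) := by
        rw [hM.gibbsWeight_eq β, ← hU, hw, mulVec_mulVec, mulVec_mulVec]
    _ = ((Real.exp (-(β * lam)) : ℝ) : ℂ) • (U *ᵥ (star U *ᵥ v)) := by
        rw [hEw, mulVec_smul]
    _ = ((Real.exp (-(β * lam)) : ℝ) : ℂ) • v := by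
        rw [mulVec_mulVec, Unitary.mul_star_self_of_mem hUu, one_mulVec]

variable {k : Type*} [Fintype k] [DecidableEq k]

omit [DecidableEq n] in
/-- For an isometry `B` (`Bᴴ B = 1`) whose range projection `B Bᴴ` commutes with `M`:
`M B = B (Bᴴ M B)`. [folklore] -/
theorem mul_frame_eq_frame_mul_compress {B : Matrix n k ℂ} (hB : Bᴴ * B = 1) {M : Matrix n n ℂ}
    (hPM : Commute (B * Bᴴ) M) : M * B = B * (Bᴴ * M * B) := by
  calc M * B = M * (B * (Bᴴ * B)) := by rw [hB, Matrix.mul_one]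
    _ = (M * (B * Bᴴ)) * B := by simp only [Matrix.mul_assoc]
    _ = ((B * Bᴴ) * M) * B := by rw [hPM.eq]
    _ = B * (Bᴴ * M * B) := by simp only [Matrix.mul_assoc]

omit [DecidableEq n] [Fintype k] [DecidableEq k] in
/-- The compression `Bᴴ M B` of a Hermitian matrix is Hermitian. [folklore] -/
theorem isHermitian_compress (B : Matrix n k ℂ) {M : Matrix n n ℂ} (hM : M.IsHermitian) :
    (Bᴴ * M * B).IsHermitian :=
  Matrix.isHermitian_conjTranspose_mul_mul B hM

/-- **Frame compression of the Gibbs weight.** For an isometry `B : ℂᵏ → ℂⁿ` (`Bᴴ B = 1`) whose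
range projection `B Bᴴ` commutes with the Hermitian `M`: `Bᴴ e^{-βM} B = e^{-β BᴴMB}`. (Both sides
act on an eigenbasis `wⱼ` of `M̃ = BᴴMB` by `e^{-βμⱼ}`: `B wⱼ` is a `μⱼ`-eigenvector of `M`.)
[folklore] -/
theorem frame_conjTranspose_gibbsWeight_mul {B : Matrix n k ℂ} (hB : Bᴴ * B = 1)
    {M : Matrix n n ℂ} (hM : M.IsHermitian) (hPM : Commute (B * Bᴴ) M) (β : ℝ) :
    Bᴴ * gibbsWeight β M * B = gibbsWeight β (Bᴴ * M * B) := by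
  set Mt : Matrix k k ℂ := Bᴴ * M * B with hMt
  have hMt' : Mt.IsHermitian := by rw [hMt]; exact isHermitian_compress B hM
  set W : Matrix k k ℂ := (hMt'.eigenvectorUnitary : Matrix k k ℂ) with hW
  have hWu : W ∈ unitary (Matrix k k ℂ) := hMt'.eigenvectorUnitary.prop
  -- both sides agree on the eigenvectors of `Mt`
  have hcol : ∀ j : k, (Bᴴ * gibbsWeight β M * B) *ᵥ ⇑(hMt'.eigenvectorBasis j) =
      gibbsWeight β Mt *ᵥ ⇑(hMt'.eigenvectorBasis j) := by
    intro j
    set w : k → ℂ := ⇑(hMt'.eigenvectorBasis j) with hw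
    have hMtw : Mt *ᵥ w = ((hMt'.eigenvalues j : ℝ) : ℂ) • w := hMt'.mulVec_eigenvectorBasis j
    -- `B w` is an eigenvector of `M`
    have hMBw : M *ᵥ (B *ᵥ w) = ((hMt'.eigenvalues j : ℝ) : ℂ) • (B *ᵥ w) := by
      rw [mulVec_mulVec, mul_frame_eq_frame_mul_compress hB hPM, ← hMt, ← mulVec_mulVec, hMtw,
        mulVec_smul]
    rw [gibbsWeight_mulVec_of_eigenvector hMt' hMtw β, ← mulVec_mulVec, ← mulVec_mulVec,
      gibbsWeight_mulVec_of_eigenvector hM hMBw β, mulVec_smul, mulVec_mulVec, hB, one_mulVec]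
  -- hence `X * W = Y * W`, and `W` is invertible
  have hXW : (Bᴴ * gibbsWeight β M * B) * W = gibbsWeight β Mt * W := by
    ext i j
    have h := congrFun (hcol j) i
    simp only [mulVec, dotProduct] at h
    simp only [Matrix.mul_apply, hW, Matrix.IsHermitian.eigenvectorUnitary_apply]
    exact h
  calc Bᴴ * gibbsWeight β M * B = (Bᴴ * gibbsWeight β M * B) * W * star W := by
        rw [Matrix.mul_assoc _ W, Unitary.mul_star_self_of_mem hWu, Matrix.mul_one]
    _ = gibbsWeight β Mt * W * star W := by rw [hXW]
    _ = gibbsWeight β Mt := by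
        rw [Matrix.mul_assoc _ W, Unitary.mul_star_self_of_mem hWu, Matrix.mul_one]

/-- **Sector partition function = partition function of the compressed Hamiltonian**:
`tr (B Bᴴ e^{-βM}) = tr e^{-β BᴴMB}` under the hypotheses of
`frame_conjTranspose_gibbsWeight_mul`. [folklore] -/
theorem sector_trace_gibbsWeight_eq {B : Matrix n k ℂ} (hB : Bᴴ * B = 1) {M : Matrix n n ℂ}
    (hM : M.IsHermitian) (hPM : Commute (B * Bᴴ) M) (β : ℝ) :
    (B * Bᴴ * gibbsWeight β M).trace = partitionFn β (Bᴴ * M * B) := by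
  rw [partitionFn, ← frame_conjTranspose_gibbsWeight_mul hB hM hPM β, Matrix.mul_assoc,
    trace_mul_comm, Matrix.mul_assoc]

/-- **Sector Gibbs numerators compress**: `tr (B Bᴴ e^{-βM} Y) = tr (e^{-β BᴴMB} · BᴴYB)` for ANY
observable `Y` (no commutation with the sector needed), under the hypotheses of
`frame_conjTranspose_gibbsWeight_mul`. [folklore] -/
theorem sector_trace_gibbsWeight_mul_eq {B : Matrix n k ℂ} (hB : Bᴴ * B = 1) {M : Matrix n n ℂ}
    (hM : M.IsHermitian) (hPM : Commute (B * Bᴴ) M) (β : ℝ) (Y : Matrix n n ℂ) :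
    (B * Bᴴ * gibbsWeight β M * Y).trace = (gibbsWeight β (Bᴴ * M * B) * (Bᴴ * Y * B)).trace := by
  -- `e^{-βM}` commutes with `P = B Bᴴ`, so `Bᴴ e^{-βM} = Bᴴ e^{-βM} B Bᴴ`
  have hPW : Commute (B * Bᴴ) (gibbsWeight β M) := by
    have : Commute (B * Bᴴ) (-(β : ℂ) • M) := hPM.smul_right _
    exact this.exp_right
  have hBW : Bᴴ * gibbsWeight β M = Bᴴ * gibbsWeight β M * B * Bᴴ := by
    calc Bᴴ * gibbsWeight β M = (Bᴴ * B) * Bᴴ * gibbsWeight β M := by rw [hB, Matrix.one_mul]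
      _ = Bᴴ * ((B * Bᴴ) * gibbsWeight β M) := by simp only [Matrix.mul_assoc]
      _ = Bᴴ * (gibbsWeight β M * (B * Bᴴ)) := by rw [hPW.eq]
      _ = Bᴴ * gibbsWeight β M * B * Bᴴ := by simp only [Matrix.mul_assoc]
  rw [← frame_conjTranspose_gibbsWeight_mul hB hM hPM β]
  calc (B * Bᴴ * gibbsWeight β M * Y).trace = (B * (Bᴴ * gibbsWeight β M * Y)).trace := by
        simp only [Matrix.mul_assoc]
    _ = ((Bᴴ * gibbsWeight β M) * (Y * B)).trace := by
        rw [trace_mul_comm]; simp only [Matrix.mul_assoc]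
    _ = ((Bᴴ * gibbsWeight β M * B * Bᴴ) * (Y * B)).trace := by
        conv_lhs => rw [hBW]
    _ = (Bᴴ * gibbsWeight β M * B * (Bᴴ * Y * B)).trace := by simp only [Matrix.mul_assoc]

end Summit.HubbardSuperconductivity.HubbardSuperconductivity.Theorems.BirGroundStateAverageLRO.Softmin
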